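import Mathlib.Analysis.Distribution.SchwartzSpace.Basic
import Literature.Analysis.FluidPDE.TaoAveragedEuler
import HarnessLib

/-!
# Route OddMorawetz — `MorawetzKillsTypeI`, reflection preserves the Schwartz class
(item stmt-NavierStokesRegularity-1377, stub `stub_reflect_schwartz`)

The spatial reflection `P v (x) := −v(−x)` used to kill even derivative weights in the
Morawetz-certificate argument maps Schwartz vector fields on `ℝ³` to Schwartz vector fields:
if `v = ⇑f` for `f : 𝓢(ℝ³, ℝ³)`, then `P v = ⇑(-(f ∘ (x ↦ -x)))`, where composition with the
continuous linear equivalence `x ↦ -x` is Mathlib's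
`SchwartzMap.compCLMOfContinuousLinearEquiv ℝ (ContinuousLinearEquiv.neg ℝ)` and negation is the
pointwise negation on `𝓢`. Both identifications hold definitionally.
-/

set_option linter.dupNamespace false

namespace Summit.NavierStokesRegularity.NavierStokesRegularity.Theorems

open scoped SchwartzMap

/-- **Reflection preserves the Schwartz class** (item stmt-NavierStokesRegularity-1377, route
OddMorawetz, stub `stub_reflect_schwartz`): for every Schwartz vector field `v` on `ℝ³`, the
reflected field `P v (x) = −v(−x)` is again Schwartz. Witness: the Schwartz map
`-(SchwartzMap.compCLMOfContinuousLinearEquiv ℝ (ContinuousLinearEquiv.neg ℝ) f)` whenever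
`v = ⇑f`. -/
theorem stub_reflect_schwartz :
    ∀ v : EuclideanSpace ℝ (Fin 3) → EuclideanSpace ℝ (Fin 3),
      Literature.Analysis.FluidPDE.IsSchwartzField v →
      Literature.Analysis.FluidPDE.IsSchwartzField (fun x => -v (-x)) := by
  rintro v ⟨f, rfl⟩
  exact ⟨-(SchwartzMap.compCLMOfContinuousLinearEquiv ℝ (ContinuousLinearEquiv.neg ℝ) f), rfl⟩

end Summit.NavierStokesRegularity.NavierStokesRegularity.Theorems
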